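import Summits.BirchSwinnertonDyer.BirchSwinnertonDyer.Theorems.ResidualThetaTransportAtTwoResidualSignedLambdaLowerCMAtTwoStationEThetaRingHom
import Summits.BirchSwinnertonDyer.BirchSwinnertonDyer.Theorems.ResidualThetaTransportAtTwoResidualSignedLambdaLowerCMAtTwoPriceNode
import Summits.BirchSwinnertonDyer.BirchSwinnertonDyer.Theorems.ResidualThetaTransportAtTwoResidualSignedLambdaLowerCMAtTwoSupplyCountPins
import Summits.BirchSwinnertonDyer.BirchSwinnertonDyer.Theorems.ResidualThetaTransportAtTwoResidualSignedLambdaLowerCMAtTwoCofreeTorsionCount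
import Summits.BirchSwinnertonDyer.BirchSwinnertonDyer.Theorems.ResidualThetaTransportAtTwoPollackPairKUnique
import HarnessLib

/-!
# Station (E) of the KZ_g interior AT THE PINS: the trivialisation `e : ℤ₂⟦X⟧ⁿ ≃+ Λ_𝒪`, `ℤ₂⟦X⟧`-semilinear, with
# `e (𝒸 (s • x)) = s · e (𝒸 x)` for EVERY `s ∈ Λ_𝒪` and EVERY `x ∈ 𝐇¹_Γ(T_ρ)` (`𝒸 = π.cvec` the Coleman coordinates of the one-pair pins)

Route `ResidualThetaTransportAtTwo` (RTT), crux RSL_g `ResidualSignedLambdaLowerCMAtTwo` (stmt-BirchSwinnertonDyer-22608), line «onepair» v3f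
(skeleton sha16 b54462f6d406cd17), registered KERNEL stub `stub_kzgTrivialisation` = station (E) (LEAD rtt-p2 g20, memo `V3F-KZG-INTERIOR-g20.md`).
Width seat `prover-bsd-wall-tp2-p2x-w2` g22 (`--supports 22608`; the by-name closer of the registered text is the separate file
`…StubKzgTrivialisation.lean`). THEOREMS ONLY (no `def`, no instance, no notation, no named fact, no `sorry`). BSD is NOT proved by any of this;
22608 / 26074 / 24105 stay OPEN / HOLD; nothing here touches the PRINT stubs (child A / child B / K0) or station (R).

PROOF (= w2 g21's closer recipe, all bricks landed): `PriceNode.exists_trivialisation` (p714652) run on `S := ⊤` with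
* LIN-X `π.cvec (X • x) = X • π.cvec x` — `OnePairPins.cvec_map_X_smul` (p711717; `pair_conjMap_of_toZModPow` + the pins' twist clause);
* LIN-𝒪 `π.cvec (C a • x) i = Σ_j C (A a i j) · π.cvec x j` and the RING HOM `A : 𝒪 →+* M_n(ℤ₂)`, `A (ι c) = c • 1` —
  `OnePairPins.exists_thetaMatrixRingHom_cvec_C_smul` (Σ_bal p720103 + integral Schur + `…StationEThetaRingHom`);
* LATTICE `Φ : 𝒪 ≃+ ℤ₂ⁿ`, `Φ (a b) = A a *ᵥ Φ b` — `PriceNode.exists_equivariant_addEquiv` with `n = f` (`CofreeTorsionCount.n_eq_of_theta` through `Θ` and the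
  pinned basis `π.B`), `𝒪` a DVR (`PollackPairK.isDiscreteValuationRing_padicCoeffIntegers`), and torsion-freeness from `2^N ∈ a𝒪` for `a ≠ 0`
  (`exists_mul_eq_padicInt_pow_of_ne_zero`, `PriceNode.htf_of_norm`).

References: [Washington1997] §7.1 Thm. 7.3, §13.2; [Kato2004Asterisque] Thm. 12.5 (1) (p. 221), §13.8 (pp. 228–229); [Kobayashi2003] Thm. 6.2 (p. 18);
[SerreInventiones1972] §1.11 Prop. 12; [Lang1990] Ch. 5 §1.
-/

set_option autoImplicit false
-- the Theorems namespace of this sub repeats the summit name by design (D-0017 nested layout)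
set_option linter.dupNamespace false

noncomputable section

open scoped Classical

namespace Summit.BirchSwinnertonDyer.BirchSwinnertonDyer.Theorems

open CategoryTheory Field NumberField IsDedekindDomain
  Literature.NumberTheory.EllipticCurves Literature.NumberTheory.GaloisRepresentations
  Literature.NumberTheory.EllipticCurves.GreenbergSelmer Literature.NumberTheory.EllipticCurves.Kobayashi2003
  Literature.NumberTheory.EllipticCurves.Kato2004 Literature.NumberTheory.EllipticCurves.Rank1Residual
  Literature.NumberTheory.EllipticCurves.Sprung2012
  Summit.BirchSwinnertonDyer.BirchSwinnertonDyer.Theorems.ThetaTransport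
  Summit.BirchSwinnertonDyer.BirchSwinnertonDyer.Theorems.OnePair

/-! ## §1 `𝒪 = 𝒪_{ℚ₂(S)}` is an order over `ℤ₂`: every `a ≠ 0` divides a power of `2` -/

namespace ThetaTransport.StationE

/-- **`2^N ∈ a·𝒪` for `a ≠ 0`** in `𝒪 = {x ∈ ℚ₂(S) : ‖x‖ ≤ 1}`: take `N` with `‖2‖^N ≤ ‖a‖`, then `a' := 2^N / a ∈ 𝒪` and `a'·a = ι(2^N)`, `2^N ≠ 0` in `ℤ₂`
— the `hnorm` input of `PriceNode.htf_of_norm`. [cite: Lang1990, Ch. 5 §1] -/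
theorem exists_mul_eq_padicInt_pow_of_ne_zero {S : Set (PadicAlgCl 2)} (a : ↥(padicCoeffIntegers S)) (ha : a ≠ 0) :
    ∃ (a' : ↥(padicCoeffIntegers S)) (c : ℤ_[2]), c ≠ 0 ∧ a' * a = padicIntToCoeffIntegers S c := by
  have ha' : (a : PadicAlgCl 2) ≠ 0 := fun h ↦ ha (Subtype.ext (by rw [h]; rfl))
  have h2 : ‖((2 : ℕ) : PadicAlgCl 2)‖ < 1 := by
    rw [← map_natCast (algebraMap ℚ_[2] (PadicAlgCl 2))]
    exact (PadicAlgCl.norm_extends 2 ((2 : ℕ) : ℚ_[2])).trans_lt Padic.norm_p_lt_one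
  obtain ⟨N, hN⟩ := exists_pow_lt_of_lt_one (norm_pos_iff.mpr ha') h2
  have hmem : ((2 : ℕ) : PadicAlgCl 2) ^ N / (a : PadicAlgCl 2) ∈ padicCoeffIntegers S := by
    refine ⟨div_mem (pow_mem (natCast_mem _ 2) N) a.2.1, ?_⟩
    rw [norm_div, norm_pow, div_le_one (norm_pos_iff.mpr ha')]
    exact hN.le
  refine ⟨⟨_, hmem⟩, ((2 : ℕ) : ℤ_[2]) ^ N, pow_ne_zero N (Nat.cast_ne_zero.mpr two_ne_zero), Subtype.ext ?_⟩
  rw [Subring.coe_mul, coe_padicIntToCoeffIntegers, PadicInt.coe_pow, PadicInt.coe_natCast, map_pow, map_natCast]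
  exact div_mul_cancel₀ _ ha'

/-- `𝒪 ≠ 0`, so an additive `𝒪 ≃+ ℤ₂ⁿ` forces `0 < n`. [folklore] -/
theorem pos_of_addEquiv_pi {𝒪 : Type*} [Ring 𝒪] [Nontrivial 𝒪] {R : Type*} [AddMonoid R] {n : ℕ} (B : 𝒪 ≃+ (Fin n → R)) :
    0 < n := by
  refine Nat.pos_of_ne_zero fun h0 ↦ ?_
  haveI : IsEmpty (Fin n) := ⟨fun i ↦ absurd i.2 (by omega)⟩
  exact zero_ne_one (B.injective (Subsingleton.elim (B (0 : 𝒪)) (B 1)))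

end ThetaTransport.StationE

/-! ## §2 Station (E) at the pins -/

namespace OnePair.OnePairPins

variable {S : Set (PadicAlgCl 2)} {W : WeierstrassCurve ℚ} [W.IsElliptic] [W.IsGloballyMinimal] {κ : ZpExtension ℚ 2}
  {γ : absoluteGaloisGroup ℚ} {S₀ : Finset (HeightOneSpectrum (𝓞 ℚ))} {n : ℕ} {ρ : FramedGaloisRep ℚ ↥(padicCoeffIntegers S) 2}
  {Θ : ∀ v : HeightOneSpectrum (𝓞 ℚ), ((2 : ℕ) : 𝓞 ℚ) ∈ v.asIdeal → (Cofree ρ ↥(padicCoeffField S) ≃+ (Fin n → ↥(W.geomPrimaryTorsion 2)))}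
  {hΘ : ∀ v hv (δ : absoluteGaloisGroup (v.adicCompletion ℚ)) m i,
    Θ v hv (resGalOfEmb (closureEmb (K := ℚ) (v.adicCompletion ℚ)) δ • m) i = resGalOfEmb (closureEmb (K := ℚ) (v.adicCompletion ℚ)) δ • Θ v hv m i}
  {I : Kato2004.IwasawaH1DataCoeff (FramedGaloisRep.toGaloisRep ρ) 2 κ γ}
  {Sg : AddSubgroup (subgroupH1 κ.kerSubgroup (Cofree ρ ↥(padicCoeffField S)))} [Module ↥(padicCoeffIntegers S) ↥Sg]
  (π : OnePairPins S W κ γ S₀ n ρ Θ hΘ I Sg)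

omit [W.IsGloballyMinimal] in
/-- **The pinned `ℤ₂`-basis of `𝒪` re-indexed by `Fin n` (`n = f` through `Θ`)**: an additive `B : 𝒪 ≃+ ℤ₂ⁿ` with `B (ι c * b) = c • B b`.
[cite: Kato2004Asterisque, §13.8 (p. 228)] -/
theorem exists_addEquiv_pi_fin_n (π : OnePairPins S W κ γ S₀ n ρ Θ hΘ I Sg) :
    ∃ B : ↥(padicCoeffIntegers S) ≃+ (Fin n → ℤ_[2]), ∀ (c : ℤ_[2]) (b : ↥(padicCoeffIntegers S)), B (padicIntToCoeffIntegers S c * b) = c • B b := by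
  have hnf : n = π.f := CofreeTorsionCount.n_eq_of_theta S ρ W π.B (Θ π.v π.hv)
  let L : (Fin π.f → ℤ_[2]) ≃ₗ[ℤ_[2]] (Fin n → ℤ_[2]) := LinearEquiv.funCongrLeft ℤ_[2] ℤ_[2] (finCongr hnf)
  refine ⟨π.B.symm.trans L.toAddEquiv, fun c b ↦ ?_⟩
  have hsymm : π.B.symm (padicIntToCoeffIntegers S c * b) = c • π.B.symm b :=
    π.B.injective (by rw [π.hB, AddEquiv.apply_symm_apply, AddEquiv.apply_symm_apply])
  rw [AddEquiv.trans_apply, AddEquiv.trans_apply, hsymm]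
  exact L.map_smul c (π.B.symm b)

set_option maxHeartbeats 800000 in
/-- **Station (E) at the pins.** For a one-pair pin bundle `π` on the habitat (`GoodSS W 2`, `a₂(W) = 0`, `[ℚ₂(S) : ℚ₂] < ∞`, `γ` a topological generator
of `κ`): there is an additive `e : ℤ₂⟦X⟧ⁿ ≃+ Λ_𝒪`, `ℤ₂⟦X⟧`-semilinear through `ι = padicIntToCoeffIntegers S`, carrying the Coleman coordinates
`𝒸 = π.cvec` `Λ_𝒪`-semilinearly on ALL of `𝐇¹_Γ(T_ρ)`: `e (𝒸 (s • x)) = s · e (𝒸 x)` for every `s ∈ Λ_𝒪`, `x ∈ 𝐇¹` (`PriceNode.exists_trivialisation` at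
`S := ⊤`, fed with LIN-X `cvec_map_X_smul`, LIN-𝒪 + the ring hom `exists_thetaMatrixRingHom_cvec_C_smul`, and the LATTICE `exists_equivariant_addEquiv` /
`htf_of_norm` on the re-indexed basis). [cite: Washington1997, §13.2, §7.1] [cite: Kato2004Asterisque, Thm. 12.5 (1) (p. 221), §13.8 (pp. 228–229)] -/
theorem exists_trivialisation [FiniteDimensional ℚ_[2] ↥(padicCoeffField S)] (hss : GoodSS W 2) (ha2 : W.frobeniusTrace 2 = 0)
    (hγ : κ.IsTopGenerator γ) :
    ∃ e : (Fin n → PowerSeries ℤ_[2]) ≃+ IwasawaAlgebraO S,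
      (∀ (r : PowerSeries ℤ_[2]) (t : Fin n → PowerSeries ℤ_[2]), e (r • t) = PowerSeries.map (padicIntToCoeffIntegers S) r * e t) ∧
      ∀ (s : IwasawaAlgebraO S) (x : I.H), e (π.cvec (s • x)) = s * e (π.cvec x) := by
  haveI : IsDiscreteValuationRing ↥(padicCoeffIntegers S) := PollackPairK.isDiscreteValuationRing_padicCoeffIntegers
  -- the ring hom `A` and LIN-𝒪
  obtain ⟨A, hAι, hO⟩ := π.exists_thetaMatrixRingHom_cvec_C_smul W hss ha2
  -- the lattice `Φ`
  obtain ⟨B, hB⟩ := π.exists_addEquiv_pi_fin_n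
  obtain ⟨Φ, hΦA, hΦι⟩ := PriceNode.exists_equivariant_addEquiv (padicIntToCoeffIntegers S) (StationE.pos_of_addEquiv_pi B) B hB A hAι
    (PriceNode.htf_of_norm (padicIntToCoeffIntegers S) A hAι StationE.exists_mul_eq_padicInt_pow_of_ne_zero)
  -- `𝒸` as an additive map, LIN-X, LIN-𝒪
  obtain ⟨𝒸, h𝒸⟩ := π.exists_cvecHom
  have hX : ∀ x ∈ (⊤ : Submodule (IwasawaAlgebraO S) I.H),
      𝒸 ((PowerSeries.X : IwasawaAlgebraO S) • x) = (PowerSeries.X : PowerSeries ℤ_[2]) • 𝒸 x := fun x _ ↦ by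
    have h := π.cvec_map_X_smul hγ x
    rw [PowerSeries.map_X] at h
    rw [h𝒸, h𝒸, h]
  have hO' : ∀ (a : ↥(padicCoeffIntegers S)), ∀ x ∈ (⊤ : Submodule (IwasawaAlgebraO S) I.H),
      𝒸 ((PowerSeries.C a : IwasawaAlgebraO S) • x) = fun i ↦ ∑ j, (PowerSeries.C (A a i j) : PowerSeries ℤ_[2]) * 𝒸 x j := fun a x _ ↦ by
    rw [h𝒸, h𝒸, hO a x]
  obtain ⟨e, he, hlin⟩ := PriceNode.exists_trivialisation (padicIntToCoeffIntegers S) 𝒸 ⊤ A Φ hΦA hΦι hX hO'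
  exact ⟨e, he, fun s x ↦ by rw [← h𝒸, ← h𝒸]; exact hlin s x Submodule.mem_top⟩

/-- **Station (E), per-class shape** (exactly the clauses of the registered `stub_kzgTrivialisation` after its binder prefix): for every `z ∈ 𝐇¹` an additive
`ℤ₂⟦X⟧`-semilinear `e : ℤ₂⟦X⟧ⁿ ≃+ Λ_𝒪` with `e (𝒸 (s • x)) = s · e (𝒸 x)` on `Λ_𝒪·z` (a fortiori from `exists_trivialisation`).
[cite: Washington1997, §13.2] [cite: Kato2004Asterisque, Thm. 12.5 (1) (p. 221)] -/
theorem exists_trivialisation_span [FiniteDimensional ℚ_[2] ↥(padicCoeffField S)] (hss : GoodSS W 2) (ha2 : W.frobeniusTrace 2 = 0)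
    (hγ : κ.IsTopGenerator γ) (z : I.H) :
    ∃ e : (Fin n → PowerSeries ℤ_[2]) ≃+ IwasawaAlgebraO S,
      (∀ (r : PowerSeries ℤ_[2]) (t : Fin n → PowerSeries ℤ_[2]), e (r • t) = PowerSeries.map (padicIntToCoeffIntegers S) r * e t) ∧
      ∀ (s : IwasawaAlgebraO S) (x : I.H), x ∈ Submodule.span (IwasawaAlgebraO S) ({z} : Set I.H) → e (π.cvec (s • x)) = s * e (π.cvec x) := by
  obtain ⟨e, he, hlin⟩ := π.exists_trivialisation hss ha2 hγ
  exact ⟨e, he, fun s x _ ↦ hlin s x⟩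

end OnePair.OnePairPins

end Summit.BirchSwinnertonDyer.BirchSwinnertonDyer.Theorems

end
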